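/-
Copyright (c) 2026 the pub-hodgecm-mathlib formalisation cell (harness21).  Prover seat hodgecm-mathlib-LH4-p03 (g11): STAGE 1a of the (D-RAM) «FOUR-FRAME» road, first helper
for U4's `stub_U4_table_diag_pos` (dealer LH4-plan (g10) WORD #16: «needs a skew `c` with `v_E(c) = ℓ₀`»); 2026-09-03.
-/
import Literature.NumberTheory.LocalFields.WildQuadraticDatumTrace   -- ★ p854561: `v_varpi_pow`, `sub_map_ne_zero`, `map_sub_map_eq_neg` (the datum toolkit)
import HarnessLib

/-!
# The ramified quadratic datum `(σ, ϖ, d, t)`: the REFERENCE SKEW SCALAR `c := (ϖ − σϖ)·((ϖ·σϖ)^{(d − d % 2)∕2})⁻¹` of depth `ℓ₀ = d % 2` — skew, of norm class `+`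
# relative to the different generator, of valuation `exp(−ℓ₀)`

Topic `NumberTheory/LocalFields`; namespace `Literature.NumberTheory.LocalFields.WildQuadraticDatum` (continues ★ `WildQuadraticDatumTrace`).  THEOREMS ONLY (no definition, no
instance, no notation, no named fact, no `sorry`); abstract one-field currency `[Field K] [Valued K ℤᵐ⁰]`.  Cell `pub/hodgecm-mathlib` (D-0151), crux H413 =
`stmt-HodgeConjecture-24833`; count-neutral.  THE OBJECT: the scalar of the four-frame line's REFERENCE TRANSVECTION `xPlus σ ϖ d = c·E₁₃` (DEFS LEAF №3
`Theorems/F0P3cDyRamFourFramePieces.lean`, ★ p854653): `c := (ϖ − σϖ)·((ϖ·σϖ)^k)⁻¹`, `k = (d − d % 2)∕2`.  WHAT IS PROVED (elementary; Serre III §6 Prop. 13's `𝒟 = (f′(π)) =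
(π − σπ)` is the only input): `map_refSkewScalar_eq_neg` — `σc = −c` (any `k`: `ϖ − σϖ` skew, `ϖ·σϖ` fixed); `exists_mul_map_eq_refSkewScalar_div` — `c∕(ϖ − σϖ) = z·σz`
with `z = (ϖ^k)⁻¹` (norm class `+`); `v_refSkewScalar` — `v c = exp(−(d % 2))` from `v(ϖ − σϖ) = (vϖ)^d`, `v ∘ σ = v` (a skew UNIT at even `d` «R-U», a skew UNIFORMISER at
odd `d` «R-P»∕tame — consistent with the skew parity ★ `exists_v_eq_exp_of_map_eq_neg`); `refSkewScalar_ne_zero`.  The «skew `c` with `v_E(c) = ℓ₀`» that U4's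
`stub_U4_table_diag_pos` (dealer WORD #16) and the transvection label `LabelPlus` (REF5 R5-3 (C)) consume.
HONEST LABEL: HC_CM is proved only modulo the 7 printed citations (2 remaining named inputs: hLiu418 = stmt-HodgeConjecture-24832, h413 = stmt-HodgeConjecture-24833) until rung
0 closes.

## References
* [Serre1979] J.-P. Serre, *Local Fields*, GTM 67 (1979): Ch. III §6 Prop. 13 and Remark (p. 58: the different of a totally ramified extension is `(f′(π))`).
-/

open WithZero

namespace Literature.NumberTheory.LocalFields.WildQuadraticDatum

variable {K : Type*} [Field K] [Valued K ℤᵐ⁰] {σ : K →+* K} {ϖ : K} {d : ℕ}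

omit [Valued K ℤᵐ⁰] in
/-- `ϖ·σϖ` is `σ`-fixed (it is a norm). [cite: Serre1979, Ch. III §6 Prop. 13] -/
theorem map_varpi_mul_map (hσ : ∀ x, σ (σ x) = x) : σ (ϖ * σ ϖ) = ϖ * σ ϖ := by
  rw [map_mul, hσ, mul_comm]

omit [Valued K ℤᵐ⁰] in
/-- **THE REFERENCE SCALAR IS SKEW**: `σ c = −c` for `c := (ϖ − σϖ)·((ϖ·σϖ)^k)⁻¹` (any `k`; `ϖ − σϖ` is skew, `ϖ·σϖ` is fixed). [cite: Serre1979, Ch. III §6 Prop. 13] -/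
theorem map_refSkewScalar_eq_neg (hσ : ∀ x, σ (σ x) = x) (k : ℕ) :
    σ ((ϖ - σ ϖ) * ((ϖ * σ ϖ) ^ k)⁻¹) = -((ϖ - σ ϖ) * ((ϖ * σ ϖ) ^ k)⁻¹) := by
  rw [map_mul, map_inv₀, map_pow, map_varpi_mul_map hσ, map_sub_map_eq_neg hσ, neg_mul]

/-- **THE REFERENCE SCALAR HAS NORM CLASS `+`**: `c ∕ (ϖ − σϖ) = z·σz` with `z := (ϖ^k)⁻¹` — `c` and the different generator `ϖ − σϖ` differ by a NORM.
[cite: Serre1979, Ch. III §6 Prop. 13] -/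
theorem exists_mul_map_eq_refSkewScalar_div (hϖ : Valued.v ϖ = exp (-1 : ℤ)) (hd : Valued.v (ϖ - σ ϖ) = Valued.v ϖ ^ d) (k : ℕ) :
    ∃ z : K, z * σ z = (ϖ - σ ϖ) * ((ϖ * σ ϖ) ^ k)⁻¹ / (ϖ - σ ϖ) := by
  refine ⟨(ϖ ^ k)⁻¹, ?_⟩
  rw [mul_div_cancel_left₀ _ (sub_map_ne_zero hϖ hd), map_inv₀, map_pow, ← mul_inv, ← mul_pow]

/-- **THE REFERENCE SCALAR HAS VALUATION `exp(−ℓ₀)`, `ℓ₀ = d % 2`**: with `k = (d − d % 2)∕2`, `v((ϖ − σϖ)·((ϖ·σϖ)^k)⁻¹) = exp(−d)·exp(2k) = exp(−(d % 2))` — a skew UNIT at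
even `d` («R-U»), a skew UNIFORMISER at odd `d` («R-P» ∕ tame). [cite: Serre1979, Ch. III §6 Prop. 13] -/
theorem v_refSkewScalar (hvσ : ∀ a, Valued.v (σ a) = Valued.v a) (hϖ : Valued.v ϖ = exp (-1 : ℤ))
    (hd : Valued.v (ϖ - σ ϖ) = Valued.v ϖ ^ d) :
    Valued.v ((ϖ - σ ϖ) * ((ϖ * σ ϖ) ^ ((d - d % 2) / 2))⁻¹) = exp (-((d % 2 : ℕ) : ℤ)) := by
  have h2k : 2 * ((d - d % 2) / 2) = d - d % 2 := Nat.mul_div_cancel' (Nat.dvd_sub_mod d)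
  have h1 : Valued.v (ϖ - σ ϖ) = exp (-(d : ℤ)) := by rw [hd, v_varpi_pow hϖ]
  have h2 : Valued.v (ϖ * σ ϖ) = exp (-2 : ℤ) := by
    rw [map_mul, hvσ, hϖ, ← exp_add]
    norm_num
  have h3 : Valued.v ((ϖ * σ ϖ) ^ ((d - d % 2) / 2)) = exp (-((d - d % 2 : ℕ) : ℤ)) := by
    rw [map_pow, h2, ← exp_nsmul, nsmul_eq_mul]
    congr 1
    push_cast
    omega
  rw [map_mul, map_inv₀, h1, h3, ← exp_neg, ← exp_add, exp_inj]
  omega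

/-- The reference scalar is non-zero. [cite: Serre1979, Ch. III §6 Prop. 13] -/
theorem refSkewScalar_ne_zero (hvσ : ∀ a, Valued.v (σ a) = Valued.v a) (hϖ : Valued.v ϖ = exp (-1 : ℤ))
    (hd : Valued.v (ϖ - σ ϖ) = Valued.v ϖ ^ d) :
    (ϖ - σ ϖ) * ((ϖ * σ ϖ) ^ ((d - d % 2) / 2))⁻¹ ≠ 0 := by
  intro h
  have hv := v_refSkewScalar hvσ hϖ hd
  rw [h, map_zero] at hv
  exact exp_ne_zero hv.symm

end Literature.NumberTheory.LocalFields.WildQuadraticDatum
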